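import Summits.HodgeConjecture.CorCM.HypLiu418.A3Liu418PinBettiPinning
import Summits.HodgeConjecture.CorCM.D2Bridge.PrintedCitationHypothesesT
import Summits.HodgeConjecture.CorCM.D2Bridge.NotHJAlbStarBijectiveOfLemma24
import Summits.HodgeConjecture.CorCM.D2Bridge.ComponentAlbanesePinLaw
import HarnessLib

/-!
# Line `a3-liu418`, GAP 1 AT THE PIN — the consequent of `StubPinBettiPinning` from [Liu2021, Lem. 2.4 (1)]

Cell `hodgecm-mathlib`, fan A, rung A-III; Summits lane `CorCM/HypLiu418/`; seat A-p18 (director g1 2026-08-28T02:56:13Z (2),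
A-plan2 g1 03:02:04Z (1)).  The v4 skeleton of line `a3-liu418` registers
`StubPinBettiPinning := StubAlbaneseH1Comparison → ∀ hDel F [IsGalois ℚ F] h6 {ι₁} V a Φ, ∃ τ', Nonempty ((CV hDel F V Φ).BettiPinning
(TV hDel F h6 V Φ) τ' PIN.H (Representation.ofModule' _))`, where `CV` is `V`'s own §4.2 datum `sec42DataOf … isoOf`, `TV` its family of
Hecke translates `heckeTranslatesFamilyOf heckeTranslate_definedOver_holds …`, and `PIN.H = (liuDictionaryPin ⋯ V I line).H` is THE PIN's
tower module `Tower hHD⋆ hI⋆ (ballQuotientUniformisedDatum_of h₁⋆) h₃⋆ hA⋆ V` (`LiuDictionary.ofTower_H`, `rfl`) with its natural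
`ℂ[𝔾(𝔸_F^∞)]`-module structure (`HodgeCM.Model.TowerAlgebra`).

`pinBettiPinning_of_lemma24` proves that CONSEQUENT at every face, with `τ' := ῑ₁ = conj ∘ ι₁` (the geometric-pin instance
`algebraMap F ℂ := ῑ₁`, under which `algebraMap ∘ c = ι₁`), from the ONE named fact the antecedent row III-0 stands on:
`hL : Liu2021.albanese_bettiOne_pullback_bijective` ([Liu2021] Lem. 2.4 (1): `alb_K^* : H¹_B(A_K) → H¹_B(Sh_K)` is bijective;
`Lemma24BettiAlbanese.lean`; A-p16's `AlbaneseH1ComparisonOfLemma24` derives `StubAlbaneseH1Comparison` from the same `hL`).  It is the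
generic pinning `nonempty_bettiPinning_of_componentAlbanese` (A3Liu418PinBettiPinning) at the tree's J2 value
`J := componentAlbanesePinTotal …` (its level law `componentAlbanesePinTotal_levelLaw`, its `alb_K^* ⊗ 1` bijective at every level by
`LevelQReps.bijective_albStarQ_componentAlbanesePinTotal_of_lemma24 hL`), with the pin's `_holds` witnesses.  So the v4 stub closes as
`stub_pinBettiPinning := fun _ => pinBettiPinning_of_lemma24 hL` once the skeleton threads `hL` (D-0014: a named-fact binder, not a
`sorry`); nothing is asserted unconditionally; HC_CM is proved only modulo the 7 printed citations until rung 0 closes.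

## References
* [Liu2021] §4.2 (FJcycle.tex l. 2062–2081: the Betti tower `H¹_{B,τ'}(A_∞, ℂ)` and its Hecke action), Lem. 2.4 (1) (l. 1210–1228),
  Thm. 4.18 proof (l. 2247–2257).
* [Deligne1979ShimuraVarieties] §2.1 (complex points of the canonical model as the ball-quotient tower).
-/

set_option autoImplicit false

noncomputable section

namespace Summit.HodgeConjecture.CorCM.Lines.A3Liu418

open scoped TensorProduct Matrix
open NumberField NumberField.InfinitePlace
open HodgeCM.Model HodgeCM.Model.LiuIndex HodgeCM.Model.TowerCarrier
open Summit.HodgeConjecture.CorCM.Model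
open Literature.AlgebraicGeometry.Motives (CMType)
open Literature.AlgebraicGeometry.HodgeTheory Literature.NumberTheory.Automorphic.PicardCM
open Literature.AlgebraicGeometry.ShimuraVarieties.UnitaryCanonicalModel
open Literature.NumberTheory.ComplexMultiplication
open Literature.NumberTheory.Automorphic
open Literature.NumberTheory.Automorphic.Liu2021 Literature.NumberTheory.Automorphic.Liu2021.AppendixC
open Literature.NumberTheory.Automorphic.Liu2021.AppendixC.RestOne
open Summit.HodgeConjecture.CorCM.Transposition.OmegaTransport (realUnit)
open Literature.RepresentationTheory Literature.RepresentationTheory.Liu2021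
open Summit.HodgeConjecture.CorCM.Transposition
open Summit.HodgeConjecture.CorCM.D2Bridge
open Summit.HodgeConjecture.CorCM.D2Bridge.MuKeyIdentLemD3End
open Summit.HodgeConjecture.CorCM.D2Bridge.MuKeyIdentLemD3DelRecConjOmegaEndT

set_option synthInstance.maxHeartbeats 400000 in
set_option maxHeartbeats 4000000 in
/-- **GAP 1 at the pin (the consequent of `StubPinBettiPinning`) from [Liu2021, Lem. 2.4 (1)].**  Given the named fact
`hL : albanese_bettiOne_pullback_bijective` (`alb_K^*` bijective on rational `H¹_B`), at every face `(hDel, F, ι₁, V, a, Φ)` with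
`6 ≤ [F:ℚ]` there is an embedding `τ'` — namely `ῑ₁ = conj ∘ ι₁` — and a Betti pinning of THE PIN's tower module
`(liuDictionaryPin ⋯ V I line).H` (with its natural `ℂ[𝔾(𝔸_F^∞)]`-action `Representation.ofModule' _`) to the Albanese Betti levels
`H¹_{B,τ'}(A_K, ℂ)` of `V`'s own §4.2 datum along its Hecke translates: `b_K := (towerLevel Γ_K ↪ Tower) ∘ levelι ∘ (alb_K^* ⊗ 1) ∘ Θ_{A_K}⁻¹`
(`nonempty_bettiPinning_of_componentAlbanese` at `componentAlbanesePinTotal`, levels `Γ_K.K = K`, bijectivity from `hL`).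
[cite: Liu2021, §4.2 l. 2074–2081; Lem. 2.4 (1) l. 1210–1228; Thm. 4.18 proof l. 2247–2257] -/
theorem pinBettiPinning_of_lemma24 (hL : albanese_bettiOne_pullback_bijective) :
    ∀ (hDel : Literature.AlgebraicGeometry.ShimuraVarieties.UnitaryCanonicalModel.canonicalModel_exists_printed)
      (F : HodgeCM.CMField) [IsGalois ℚ F] (h6 : 6 ≤ Module.finrank ℚ F) {ι₁ : F →+* ℂ} (V : HodgeCM.HermSpace3 F ι₁) (a : RealScalar F)
      (Φ : CMType F),
      ∃ τ' : (F : Type) →+* ℂ, Nonempty ((sec42DataOf (Summit.HodgeConjecture.CorCM.DelRec.exists_recordSystem_of_printed hDel) isoOf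
        ⟨HodgeCM.CMField.K F⟩ ι₁ ⟨HodgeCM.HermSpace3.Hm V, HodgeCM.HermSpace3.isHermitian V, HodgeCM.HermSpace3.signature_ι₁ V,
          HodgeCM.HermSpace3.posDef_of_ne V⟩ Φ).BettiPinning
        (heckeTranslatesFamilyOf heckeTranslate_definedOver_holds (Summit.HodgeConjecture.CorCM.DelRec.exists_recordSystem_of_printed hDel)
          isoOf ⟨HodgeCM.CMField.K F⟩ ι₁ ⟨HodgeCM.HermSpace3.Hm V, HodgeCM.HermSpace3.isHermitian V, HodgeCM.HermSpace3.signature_ι₁ V,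
            HodgeCM.HermSpace3.posDef_of_ne V⟩ Φ h6)
        τ'
        ((liuDictionaryPin exists_isReal_hodgeModel_holds hodgePQ_independent_of_hodgeModel_holds BallQuotient.ballQuotientUniformised_holds
            (cmAbelianVarietyRealised_of_eigenbasis exists_isReal_hodgeModel_holds hodgePQ_independent_of_hodgeModel_holds
              cmAbelianVarietyEigenbasisRealised_holds)
            Literature.NumberTheory.Transcendental.arapura2012_cor_15_4_6_holds V (I V (repAt a) (muLiu ι₁ GramClass.rep))
            (line V (repAt a) (muLiu ι₁ GramClass.rep))).H)
        (Representation.ofModule' _)) := by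
  intro hDel F _ h6 ι₁ V a Φ
  -- the geometric-pin instance `algebraMap F ℂ := ῑ₁ = conj ∘ ι₁`, under which `algebraMap ∘ c = ι₁`
  letI : Algebra (F : Type) ℂ := ((starRingEnd ℂ).comp ι₁).toAlgebra
  have hinst : ∀ x : F, algebraMap (F : Type) ℂ x = ((starRingEnd ℂ).comp ι₁) x := fun _ => rfl
  have hι : (algebraMap (F : Type) ℂ).comp (cmConjRingHom F) = ι₁ := by
    ext x
    rw [RingHom.coe_comp, Function.comp_apply, hinst, embedding_cmConjRingHom, RingHom.coe_comp, Function.comp_apply,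
      starRingEnd_self_apply]
  have h4 : 4 ≤ Module.finrank ℚ F := le_trans (by norm_num) h6
  exact ⟨algebraMap (F : Type) ℂ,
    nonempty_bettiPinning_of_componentAlbanese exists_isReal_hodgeModel_holds hodgePQ_independent_of_hodgeModel_holds
      (ballQuotientUniformisedDatum_of BallQuotient.ballQuotientUniformised_holds)
      (cmAbelianVarietyRealised_of_eigenbasis exists_isReal_hodgeModel_holds hodgePQ_independent_of_hodgeModel_holds
        cmAbelianVarietyEigenbasisRealised_holds)
      Literature.NumberTheory.Transcendental.arapura2012_cor_15_4_6_holds V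
      (Summit.HodgeConjecture.CorCM.DelRec.exists_recordSystem_of_printed hDel) Φ _ _ h4
      (componentAlbanesePinTotal exists_isReal_hodgeModel_holds hodgePQ_independent_of_hodgeModel_holds
        (ballQuotientUniformisedDatum_of BallQuotient.ballQuotientUniformised_holds)
        (cmAbelianVarietyRealised_of_eigenbasis exists_isReal_hodgeModel_holds hodgePQ_independent_of_hodgeModel_holds
          cmAbelianVarietyEigenbasisRealised_holds)
        Literature.NumberTheory.Transcendental.arapura2012_cor_15_4_6_holds heckeTranslate_definedOver_holds V
        (Summit.HodgeConjecture.CorCM.DelRec.exists_recordSystem_of_printed hDel) h4 hι Φ isoOf)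
      (componentAlbanesePinTotal_levelLaw exists_isReal_hodgeModel_holds hodgePQ_independent_of_hodgeModel_holds
        (ballQuotientUniformisedDatum_of BallQuotient.ballQuotientUniformised_holds)
        (cmAbelianVarietyRealised_of_eigenbasis exists_isReal_hodgeModel_holds hodgePQ_independent_of_hodgeModel_holds
          cmAbelianVarietyEigenbasisRealised_holds)
        Literature.NumberTheory.Transcendental.arapura2012_cor_15_4_6_holds heckeTranslate_definedOver_holds V
        (Summit.HodgeConjecture.CorCM.DelRec.exists_recordSystem_of_printed hDel) h4 hι Φ isoOf)
      (LevelQReps.bijective_albStarQ_componentAlbanesePinTotal_of_lemma24 hL V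
        (ballQuotientUniformisedDatum_of BallQuotient.ballQuotientUniformised_holds)
        (cmAbelianVarietyRealised_of_eigenbasis exists_isReal_hodgeModel_holds hodgePQ_independent_of_hodgeModel_holds
          cmAbelianVarietyEigenbasisRealised_holds)
        h4 (Summit.HodgeConjecture.CorCM.DelRec.exists_recordSystem_of_printed hDel) exists_isReal_hodgeModel_holds hι
        hodgePQ_independent_of_hodgeModel_holds Literature.NumberTheory.Transcendental.arapura2012_cor_15_4_6_holds
        heckeTranslate_definedOver_holds Φ isoOf)⟩

end Summit.HodgeConjecture.CorCM.Lines.A3Liu418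

end
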